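import Summits.HodgeConjecture.HodgeConjecture.Theorems.HeckePrymWeilWeilTwelvefoldsSqrtMinus7CmSurfaceDescentPairGeneral
import HarnessLib

/-!
# Crux `WeilTwelvefoldsSqrtMinus7` (stmt-HodgeConjecture-1261), line `amnesic-secant-sheaves-split-fourteenfolds` — stub T_B `stub_cmSurfaceDescentPair` (d = 7)

The registered stub T_B of the lead's skeleton (`Cruxes/WeilTwelvefoldsSqrtMinus7/Lines/amnesic_secant_sheaves_split_fourteenfolds_c1.lean`):
the CM Weil surface `E × E`, `ψ = (φ, -φ)`, with its descent pair, for `φ ≫ φ = -7`. PROVED by the lead's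
stub-worker (proposal p104778/p107673, whose lemmas landed as `…CmSurfaceDescentPairLemmas`); since the
general-`d` form `cmSurfaceDescentPair_general` (`…CmSurfaceDescentPairGeneral`, same proof with `7 ↦ d`)
reached the tree first, this file is — as the reviewer of p107673 asked — the ONE-LINE specialisation `d = 7`
(the casts `((7 : ℕ) : ℤ)`, `((7 : ℕ) : ℝ)` of the general statement are the literals by `Nat.cast_ofNat`).
-/

noncomputable section

set_option linter.dupNamespace false

open CategoryTheory Complex
open Literature.AlgebraicGeometry Literature.AlgebraicGeometry.Motives
  Literature.AlgebraicGeometry.HodgeTheory Literature.AlgebraicTopology.SingularHomology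

namespace Summit.HodgeConjecture.HodgeConjecture.Theorems.WeilTwelvefoldsSqrtMinus7.AmnesicSecantSheaves

/-- **Stub T_B — the CM Weil surface `E × E`, `ψ = (φ, -φ)`, and its descent pair (`d = 7`).** For a complex
elliptic curve `E` of dimension `1` with `φ ≫ φ = -7`, a rational basis `x₀, x₁` of `H¹(E(ℂ); ℂ)` on which
`φ^*` has an integer matrix, additive pull-backs, and `ω = x₀ ⌣ x₁ ≠ 0` spanning `H²`: `dim (E × E) = 2`,
`ψ ≫ ψ = -7`, and a descent pair `b₊ ∈ Eig((𝟙+ψ)^*, (1+i√7)²)`, `b₋ ∈ Eig((𝟙+ψ)^*, (1-i√7)²)`, `b₊ + b₋`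
rational of type `(1,1)`, `η ∈ N¹H²` with `b± ⌣ η ≠ 0`. The instance `d = 7` of `cmSurfaceDescentPair_general`
(worker's proof: eigenvectors `v± = φ^*x₁ ± i√7 x₁`, factorwise `(𝟙+ψ)^*`, Hodge types of the eigenlines,
Künneth for Hodge types, `η = (fst - snd)^*ω`). [cite: vanGeemen1994HodgeAV, Lemma 5.2 and 5.3]
[cite: Schoen1998HodgeWeilAddendum, §10] -/
theorem stub_cmSurfaceDescentPair :
    ∀ (E : AbelianVariety ℂ) (φ : E ⟶ E), E.dim = 1 → φ ≫ φ = -((7 : ℤ) • 𝟙 E) →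
    ∀ (x : Fin 2 → complexBetti E.X 1) (M : Matrix (Fin 2) (Fin 2) ℤ),
      (∀ i, IsRationalClass (x i)) → LinearIndependent ℂ x → Submodule.span ℂ (Set.range x) = ⊤ →
      (∀ i, complexBetti.map φ.hom.hom.hom 1 (x i) = ∑ j, ((M j i : ℤ) : ℂ) • x j) →
      (∀ (T : AbelianVariety ℂ) (f g : T ⟶ E) (i : Fin 2),
        complexBetti.map (f + g).hom.hom.hom 1 (x i) =
          complexBetti.map f.hom.hom.hom 1 (x i) + complexBetti.map g.hom.hom.hom 1 (x i)) →
      cupProduct (rfl : 1 + 1 = 2) (x 0) (x 1) ≠ 0 →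
      (∀ c : complexBetti E.X 2, ∃ t : ℂ, c = t • cupProduct (rfl : 1 + 1 = 2) (x 0) (x 1)) →
      (E.prod E).dim = 2 ∧
      AbelianVariety.prodLift (AbelianVariety.fst E E ≫ φ) (AbelianVariety.snd E E ≫ (-φ)) ≫
        AbelianVariety.prodLift (AbelianVariety.fst E E ≫ φ) (AbelianVariety.snd E E ≫ (-φ)) =
          -((7 : ℤ) • 𝟙 (E.prod E)) ∧
      ∃ bp bm η : complexBetti (E.prod E).X 2,
        bp ∈ Module.End.eigenspace (complexBetti.map (𝟙 (E.prod E) +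
              AbelianVariety.prodLift (AbelianVariety.fst E E ≫ φ) (AbelianVariety.snd E E ≫ (-φ))).hom.hom.hom 2).hom
              ((1 + Complex.I * (Real.sqrt (7 : ℝ) : ℂ)) ^ 2) ∧
        bm ∈ Module.End.eigenspace (complexBetti.map (𝟙 (E.prod E) +
              AbelianVariety.prodLift (AbelianVariety.fst E E ≫ φ) (AbelianVariety.snd E E ≫ (-φ))).hom.hom.hom 2).hom
              ((1 - Complex.I * (Real.sqrt (7 : ℝ) : ℂ)) ^ 2) ∧
        IsRationalClass (bp + bm) ∧ IsOfHodgeType 2 (E.prod E).X 2 1 1 (bp + bm) ∧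
        η ∈ algebraicClasses (E.prod E).X 1 ∧
        cupProduct (show 2 + 2 = 4 from rfl) bp η ≠ 0 ∧
        cupProduct (show 2 + 2 = 4 from rfl) bm η ≠ 0 :=
  cmSurfaceDescentPair_general 7 (by norm_num)

end Summit.HodgeConjecture.HodgeConjecture.Theorems.WeilTwelvefoldsSqrtMinus7.AmnesicSecantSheaves

end
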